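import Mathlib
import Summits.KontsevichZagierPeriods.Zeta5Search.LawA5Proof
import Summits.KontsevichZagierPeriods.Zeta5Search.DenomLaw.LawA5Shifted
import Summits.KontsevichZagierPeriods.Zeta5Search.DenomLaw.LawA5Depth8Aggregate
import HarnessLib

/-!
# ζ(5) search — THEOREM L5 AT FRAME DEPTH `M ≥ 8`, part 2/2: the residue side and the theorems `lawA5_depth8`, `lawA5_depth8_shifted`

Cell `pub-zeta5` (HONEST FRAMING: systematic search; no irrationality claim unless certified), track «DENOM-LAW», seat `denom-prover-d1`
gen 10 (ATTEMPT-10 §10–§12).  `p`-adic valuations of the cell's OWN explicit rationals (the contiguity Casoratian of the Brown–Zudilin dual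
coefficients); nothing here is a statement about ζ(5); no γ of record moves; records in print UNMOVED.

WHAT.  The tree's THEOREM L5 (`SecondResidueLaw.LawA5`, PROVED `lawA5_holds`) asks `M ≥ 10`.  Reading its proof, `M ≥ 10` is used in exactly one way: a
SINGLE-pole class has one pole of order `≤ 6`, hence exponent `E ≥ −6 ≥ −M + 4`, so it lies below the four live layers — in `negl₄` (crude bounds) and in
`liveKappaSum_small` (the pole set of the residue identity consists of multipole classes).  Everything else (`pair₅`, the frame, the residue identity
`sum_gBarE_mul_kapBar_eq_zero`, which asks `M ≥ 4`) needs only `M ≥ 7`.  Hence **THEOREM L5₈**: the hypotheses of `LawA5` with `8 ≤ M` in place of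
`10 ≤ M`, PLUS «every single-pole class of `b` and of `b + e_j` has exponent `≥ −M + 4`» ⇒ `v_p(Cas_j(b)) ≥ 8 − 2M`; and, exactly as in
`DenomLaw/LawA5Shifted.lean`, with the two deepest layers empty ⇒ `9 − 2M` (`lawA5_depth8_shifted`).  The side condition is automatic for FRAMED classes
(type lists beginning and ending with a numerator zero: one pole of order ≤ 6 plus two zeros), i.e. in the census's X-ray regime (all seven parameters ≥ p).
The proofs below are the tree's `pair₅` / `negl₄` / `aggregate₅` / `liveKappaSum_small` / `lawA5_of_residueLaw` VERBATIM with `8 ≤ M` and the side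
condition replacing the two `E ≥ −6` steps (suffix `_d8`).

WHY IT MATTERS (HOME `denom-law/prover-d1/ATTEMPT-10.md` §10–§12): the largest per-prime gap of the accounting node `DenomLaw.PathAccountingFirstPeriod` found
by this seat is the «all parameters long» family at ⌊d/p⌋ = 2 (a = 7): 14,781 configurations at p = 11, 5,686 reached by no landed rung (PATH exact-true on all);
the ported hypotheses of L5₈ / L5₈⁺ hold on 4,400 of them with 0 violations of `8 − 2M` and reach PATH's value on ≈ 3,650; exhaustive small cells (b₀ ≤ 15, all
window primes, all j): 0 violations where the side condition holds, while WITHOUT it «L5 at M = 8» fails on thousands of sparse a = 0 cells — the condition is the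
content, not a technicality.
-/

noncomputable section

open Finset PowerSeries

namespace Summit.KontsevichZagierPeriods.Zeta5Search.SecondOrder

open Summit.KontsevichZagierPeriods.Zeta5Search.WedgeDictionary (coeffW coeffV dOf)
open Summit.KontsevichZagierPeriods.Zeta5Search.CasoratianValuation (InPolytope shift casoratian)
open Summit.KontsevichZagierPeriods.Zeta5Search.ClusterValuation
open Summit.KontsevichZagierPeriods.Zeta5Search.PadicSeries
open Summit.KontsevichZagierPeriods.Zeta5Search.CellA (classW coeffW_eq_sum_classW padicNorm_p)
open Summit.KontsevichZagierPeriods.Zeta5Search.LevelClass (typeExp typeW level_mem)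
open Summit.KontsevichZagierPeriods.Zeta5Search.BigPrime (shift_zero padicNorm_mul_le_one dOf_shift)
open Summit.KontsevichZagierPeriods.Zeta5Search.RecordWindowsA4 (LawA4Classes)
open Summit.KontsevichZagierPeriods.Zeta5Search.SecondResidueLaw (phi3Hat cubicHat lambdaP isRaiseN ShapeClause FourthDigitW FourthDigitV)
open Summit.KontsevichZagierPeriods.Zeta5Search.ResidueLaw
open Summit.KontsevichZagierPeriods.Zeta5Search.ResidueFour

variable {p : ℕ} [hp : Fact p.Prime]

/-! ## §3 The residue side at frame depth 8 -/

/-- **The residue side of L5 at frame depth `M ≥ 8`** (the proof of `liveKappaSum_small` verbatim; `hsing` keeps the single-pole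
classes out of the pole set instead of `M ≥ 10`).  For `b` in the polytope, a prime `p ≥ 5`, an even
level `M ≥ 10` below every multipole class exponent and `p(M − 4) ≤ 2d + 3`, the live class sum
`Σ_{multipole, E_x ≤ −M+3} ĝ_x κ̂_x` (`κ̂ = cubicHat, curvHat, phiHat, 1` on the layers `E_x + M = 0, 1, 2, 3`) has `p`-adic norm `≤ p⁻¹`. -/
theorem liveKappaSum_small_d8 (b : ℕ → ℤ) {p : ℕ} [Fact p.Prime] (hb : InPolytope b) (hp5 : 5 ≤ p) (hpn : (p : ℤ) ≤ b 0)
    (hwin : (b 0 + 2 : ℤ) < (p : ℤ) ^ 2) {M : ℕ} (hM : 8 ≤ M) (hMe : Even M)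
    (H1 : ∀ x ∈ multipoleClasses b p, -(M : ℤ) ≤ classExp b p x)
    (hsing : ∀ y, y < p → classPoleCount b p y = 1 → -(M : ℤ) + 4 ≤ classExp b p y) (hdeg : (p : ℤ) * ((M : ℤ) - 4) ≤ 2 * dOf b + 3) :
    padicNorm p (∑ x ∈ (Finset.range p).filter (fun x => 2 ≤ classPoleCount b p x ∧ classExp b p x ≤ -(M : ℤ) + 3),
      gHat b p x * (if classExp b p x + M = 0 then cubicHat b p x else if classExp b p x + M = 1 then curvHat b p x
        else if classExp b p x + M = 2 then phiHat b p x else 1)) ≤ (p : ℚ) ^ (-(1 : ℤ)) := by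
  classical
  -- the window hypotheses belong to the interface requested by the `ClassFrame` assembly; the residue argument does not use them
  have _hwindow : (p : ℤ) ≤ b 0 ∧ (b 0 + 2 : ℤ) < (p : ℤ) ^ 2 := ⟨hpn, hwin⟩
  -- every class exponent is `≥ −M`
  have hE : ∀ y, y < p → -(M : ℤ) ≤ classExp b p y := by
    intro y hy
    by_cases h2 : 2 ≤ classPoleCount b p y
    · exact H1 y (by unfold multipoleClasses; exact mem_filter.2 ⟨mem_range.2 hy, h2⟩)
    · rcases Nat.eq_zero_or_pos (classPoleCount b p y) with h0 | hpos
      · have := ResidueLaw.classExp_nonneg_of_classPoleCount_eq_zero b p y h0; omega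
      · have := hsing y hy (by omega); omega
  -- the degree condition
  have hdeg' : (p : ℤ) * ((M : ℤ) - 4) + ∑ y ∈ range p, classExp b p y ≤ -2 := by
    rw [sum_classExp_range b hb hp5]; omega
  -- the live classes are exactly the poles of `∏ (X + w)^{E_w + M − 4}`
  have hfilt : (range p).filter (fun x => 2 ≤ classPoleCount b p x ∧ classExp b p x ≤ -(M : ℤ) + 3)
      = poleSet p (classExp b p) M := by
    ext x
    simp only [mem_filter, mem_range, mem_poleSet]
    constructor
    · rintro ⟨hx, -, hEx⟩; exact ⟨hx, by omega⟩
    · rintro ⟨hx, hEx⟩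
      refine ⟨hx, ?_, by omega⟩
      by_contra h2
      rcases Nat.eq_zero_or_pos (classPoleCount b p x) with h0 | hpos
      · have := ResidueLaw.classExp_nonneg_of_classPoleCount_eq_zero b p x h0; omega
      · have := hsing x hx (by omega); omega
  -- the abstract identity
  have hid := sum_gBarE_mul_kapBar_eq_zero (classExp b p) M hp5 (by omega) hMe hE hdeg'
  -- `p`-integrality and the image in `ZMod p`
  have hden : ∀ x ∈ poleSet p (classExp b p) M, ¬ p ∣ (gHat b p x * (if classExp b p x + M = 0 then cubicHat b p x
      else if classExp b p x + M = 1 then curvHat b p x else if classExp b p x + M = 2 then phiHat b p x else 1 : ℚ)).den :=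
    fun x hx => PInt.mul (cast_gHat b hp5 x).1 (cast_kappaHat_eq b hp5 M (mem_poleSet.1 hx).1).1
  have hcast : ∀ x ∈ poleSet p (classExp b p) M, ((gHat b p x * (if classExp b p x + M = 0 then cubicHat b p x
      else if classExp b p x + M = 1 then curvHat b p x else if classExp b p x + M = 2 then phiHat b p x else 1) : ℚ) :
        ZMod p) = 2 * (gBarE p (classExp b p) x * kapBar p (classExp b p) M x) := by
    intro x hx
    have hxp := (mem_poleSet.1 hx).1
    rw [PInt.cast_mul (cast_gHat b hp5 x).1 (cast_kappaHat_eq b hp5 M hxp).1, (cast_kappaHat_eq b hp5 M hxp).2,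
      ← gBar_eq_cast_gHat b hp5 hxp, gBar_eq b hxp, mul_assoc]
  rw [hfilt, ← PInt.cast_eq_zero_iff_norm (PInt.sum hden), PInt.cast_sum hden, sum_congr rfl hcast, ← mul_sum, hid, mul_zero]


/-! ## §4 THEOREM L5₈ and L5₈⁺ -/

/-- **THEOREM L5₈ (frame depth `M ≥ 8`).**  Hypotheses of `SecondResidueLaw.LawA5` with `8 ≤ M` and, for `b` and `b + e_j`, every single-pole class of
exponent `≥ −M + 4`.  Then `v_p(Cas_j(b)) ≥ 8 − 2M`. -/
theorem lawA5_depth8 (b : ℕ → ℤ) (j M : ℕ) (T : List ℤ) (hb : InPolytope b) (hb' : InPolytope (shift b j)) (hj : 1 ≤ j ∧ j ≤ 7)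
    (hp5 : 5 ≤ p) (hpb : (p : ℤ) ≤ b 0) (hwin : (b 0 + 2 : ℤ) < (p : ℤ) ^ 2) (hM : 8 ≤ M ∧ Even M) (hT : T.reverse = T)
    (hC : LawA4Classes b p M T) (hC' : LawA4Classes (shift b j) p M T) (hS : ShapeClause b p M T) (hS' : ShapeClause (shift b j) p M T)
    (hdeg : (p : ℤ) * ((M : ℤ) - 4) ≤ 2 * dOf b + 1)
    (hsing : ∀ y, y < p → classPoleCount b p y = 1 → -(M : ℤ) + 4 ≤ classExp b p y)
    (hsing' : ∀ y, y < p → classPoleCount (shift b j) p y = 1 → -(M : ℤ) + 4 ≤ classExp (shift b j) p y)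
    (hcas : casoratian b j ≠ 0) : (8 : ℤ) - 2 * M ≤ padicValRat p (casoratian b j) := by
  obtain ⟨hj1, hj7⟩ := hj
  obtain ⟨hM, hMe⟩ := hM
  have hprime : p.Prime := hp.out
  have hp0 : (p : ℚ) ≠ 0 := Nat.cast_ne_zero.2 hprime.ne_zero
  have hpneg : (-(p : ℚ)) ≠ 0 := neg_ne_zero.2 hp0
  have hp2 : p ≠ 2 := by omega
  have hpb' : (p : ℤ) ≤ shift b j 0 := by rw [shift_zero b hj1]; exact hpb
  have hwin' : (shift b j 0 + 2 : ℤ) < (p : ℤ) ^ 2 := by rw [shift_zero b hj1]; exact hwin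
  -- single-pole classes have `ν ≥ −M + 4` too
  have hnu : ∀ y, y < p → classPoleCount b p y = 1 → -(M : ℤ) + 3 ≤ classNu b p y :=
    fun y hy h1 => by have := (hsing y hy h1).trans (CellA.classExp_le_classNu b p y); omega
  have hnu' : ∀ y, y < p → classPoleCount (shift b j) p y = 1 → -(M : ℤ) + 3 ≤ classNu (shift b j) p y :=
    fun y hy h1 => by have := (hsing' y hy h1).trans (CellA.classExp_le_classNu (shift b j) p y); omega
  -- the minor `w'v − wv'` is `O(p⁵)`
  have hdet : padicNorm p (coeffW (shift b j) / (-(p : ℚ)) ^ (-(M : ℤ) + 3) * (coeffV b / (-(p : ℚ)) ^ (-(M : ℤ)))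
      - coeffW b / (-(p : ℚ)) ^ (-(M : ℤ) + 3) * (coeffV (shift b j) / (-(p : ℚ)) ^ (-(M : ℤ)))) ≤ (p : ℚ) ^ (-(5 : ℤ)) := by
    by_cases hA : ∃ x < p, (2 ≤ classPoleCount b p x ∧ classExp b p x ≤ -(M : ℤ) + 2) ∨
        (2 ≤ classPoleCount (shift b j) p x ∧ classExp (shift b j) p x ≤ -(M : ℤ) + 2)
    · obtain ⟨x, hx, hx'⟩ := hA
      have hTL : typeExp (tTop T) (tList T) = -(M : ℤ) ∧ tTop T < p := by
        rcases hx' with ⟨h2, hE⟩ | ⟨h2, hE⟩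
        · refine ⟨(typeExp_frame_or_top b hb hp5 hpb hMe hT hC hx h2 (by omega)).resolve_right (by omega), ?_⟩
          obtain ⟨a, hdom⟩ := live_dominates b hpb hC hS hx h2 (by omega)
          have := hdom.le; have := topLevel_lt b hb hwin x; omega
        · refine ⟨(typeExp_frame_or_top (shift b j) hb' hp5 hpb' hMe hT hC' hx h2 (by omega)).resolve_right (by omega), ?_⟩
          obtain ⟨a, hdom⟩ := live_dominates (shift b j) hpb' hC' hS' hx h2 (by omega)
          have := hdom.le; have := topLevel_lt (shift b j) hb' hwin' x; omega
      obtain ⟨hTM, hLp⟩ := hTL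
      have hres := liveKappaSum_small_d8 b hb hp5 hpb hwin hM hMe hC.1 hsing (by omega)
      have hres' := liveKappaSum_small_d8 (shift b j) hb' hp5 hpb' hwin' hM hMe hC'.1 hsing' (by rw [dOf_shift b hj1 hj7]; omega)
      obtain ⟨A, hA1, hW, hV⟩ :=
        aggregate₅_d8 b hb hp5 hpb hwin hM hMe hT hC hS fourthDigitW_holds fourthDigitV_holds hsing hTM hres
      obtain ⟨A', hA1', hW', hV'⟩ :=
        aggregate₅_d8 (shift b j) hb' hp5 hpb' hwin' hM hMe hT hC' hS' fourthDigitW_holds fourthDigitV_holds hsing' hTM hres'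
      have ht := padicNorm_frameT_le_one hp2 hLp (tList T) 1
      exact det₅ hp2 hW hV hW' hV' (padicNorm_mul_le_left hA1 ht.1) (padicNorm_mul_le_left hA1 ht.2)
        (padicNorm_mul_le_left hA1' ht.1) (padicNorm_mul_le_left hA1' ht.2)
    · -- (B) every multipole class of both vectors has `E ≥ −M + 3`: crude bounds
      have hall : ∀ x < p, 2 ≤ classPoleCount b p x → -(M : ℤ) + 3 ≤ classExp b p x := fun x hx h2 => by
        by_contra h; exact hA ⟨x, hx, Or.inl ⟨h2, by omega⟩⟩
      have hall' : ∀ x < p, 2 ≤ classPoleCount (shift b j) p x → -(M : ℤ) + 3 ≤ classExp (shift b j) p x :=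
        fun x hx h2 => by
          by_contra h; exact hA ⟨x, hx, Or.inr ⟨h2, by omega⟩⟩
      obtain ⟨hWb, hVb⟩ := coeff_norm_of_layer b hb hp5 hwin (k := 3) (by omega) hall hnu
      obtain ⟨hWb', hVb'⟩ := coeff_norm_of_layer (shift b j) hb' hp5 hwin' (k := 3) (by omega) hall' hnu'
      have hw := norm_div_neg_p_zpow hWb
      have hv := norm_div_neg_p_zpow hVb
      have hw' := norm_div_neg_p_zpow hWb'
      have hv' := norm_div_neg_p_zpow hVb'
      exact fo_sub (fo_weak (fo_mul hw' hv) (by norm_num)) (fo_weak (fo_mul hw hv') (by norm_num))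
  -- the Casoratian
  set w := coeffW b / (-(p : ℚ)) ^ (-(M : ℤ) + 3)
  set v := coeffV b / (-(p : ℚ)) ^ (-(M : ℤ))
  set w' := coeffW (shift b j) / (-(p : ℚ)) ^ (-(M : ℤ) + 3)
  set v' := coeffV (shift b j) / (-(p : ℚ)) ^ (-(M : ℤ))
  have hcasE : casoratian b j = (-(p : ℚ)) ^ (-(M : ℤ) + 3) * (-(p : ℚ)) ^ (-(M : ℤ)) * (w' * v - w * v') := by
    have e1 : coeffW b = w * (-(p : ℚ)) ^ (-(M : ℤ) + 3) := by
      simp only [w]; rw [div_mul_cancel₀ _ (zpow_ne_zero _ hpneg)]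
    have e2 : coeffV b = v * (-(p : ℚ)) ^ (-(M : ℤ)) := by
      simp only [v]; rw [div_mul_cancel₀ _ (zpow_ne_zero _ hpneg)]
    have e3 : coeffW (shift b j) = w' * (-(p : ℚ)) ^ (-(M : ℤ) + 3) := by
      simp only [w']; rw [div_mul_cancel₀ _ (zpow_ne_zero _ hpneg)]
    have e4 : coeffV (shift b j) = v' * (-(p : ℚ)) ^ (-(M : ℤ)) := by
      simp only [v']; rw [div_mul_cancel₀ _ (zpow_ne_zero _ hpneg)]
    unfold casoratian
    rw [e1, e2, e3, e4]; ring
  apply val_ge_of_padicNorm_le hcas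
  rw [hcasE, padicNorm.mul, padicNorm.mul, LevelClass.padicNorm_neg_p_zpow, LevelClass.padicNorm_neg_p_zpow]
  calc (p : ℚ) ^ (-(-(M : ℤ) + 3)) * (p : ℚ) ^ (-(-(M : ℤ))) * padicNorm p (w' * v - w * v')
      ≤ (p : ℚ) ^ (-(-(M : ℤ) + 3)) * (p : ℚ) ^ (-(-(M : ℤ))) * (p : ℚ) ^ (-(5 : ℤ)) :=
        mul_le_mul_of_nonneg_left hdet (mul_nonneg (zpow_p_nonneg _) (zpow_p_nonneg _))
    _ = (p : ℚ) ^ (-((8 : ℤ) - 2 * M)) := by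
        rw [← zpow_add₀ hp0, ← zpow_add₀ hp0]; congr 1; ring

/-- **THEOREM L5₈⁺ (frame depth `M ≥ 8`, two empty layers).**  Hypotheses of `lawA5_depth8` and, for `b` and `b + e_j`, every multipole class exponent
`≥ −M + 2` and every single-pole `ν ≥ −M + 2`: `v_p(Cas_j(b)) ≥ 9 − 2M`. -/
theorem lawA5_depth8_shifted (b : ℕ → ℤ) (j M : ℕ) (T : List ℤ) (hb : InPolytope b) (hb' : InPolytope (shift b j)) (hj : 1 ≤ j ∧ j ≤ 7)
    (hp5 : 5 ≤ p) (hpb : (p : ℤ) ≤ b 0) (hwin : (b 0 + 2 : ℤ) < (p : ℤ) ^ 2) (hM : 8 ≤ M ∧ Even M) (hT : T.reverse = T)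
    (hC : LawA4Classes b p M T) (hC' : LawA4Classes (shift b j) p M T) (hS : ShapeClause b p M T) (hS' : ShapeClause (shift b j) p M T)
    (hdeg : (p : ℤ) * ((M : ℤ) - 4) ≤ 2 * dOf b + 1)
    (hsing : ∀ y, y < p → classPoleCount b p y = 1 → -(M : ℤ) + 4 ≤ classExp b p y)
    (hsing' : ∀ y, y < p → classPoleCount (shift b j) p y = 1 → -(M : ℤ) + 4 ≤ classExp (shift b j) p y)
    (hE2 : ∀ x < p, 2 ≤ classPoleCount b p x → -(M : ℤ) + 2 ≤ classExp b p x)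
    (hN2 : ∀ y < p, classPoleCount b p y = 1 → -(M : ℤ) + 2 ≤ classNu b p y)
    (hE2' : ∀ x < p, 2 ≤ classPoleCount (shift b j) p x → -(M : ℤ) + 2 ≤ classExp (shift b j) p x)
    (hN2' : ∀ y < p, classPoleCount (shift b j) p y = 1 → -(M : ℤ) + 2 ≤ classNu (shift b j) p y)
    (hcas : casoratian b j ≠ 0) : (9 : ℤ) - 2 * M ≤ padicValRat p (casoratian b j) := by
  obtain ⟨hj1, hj7⟩ := hj
  obtain ⟨hM, hMe⟩ := hM
  have hprime : p.Prime := hp.out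
  have hp0 : (p : ℚ) ≠ 0 := Nat.cast_ne_zero.2 hprime.ne_zero
  have hpneg : (-(p : ℚ)) ≠ 0 := neg_ne_zero.2 hp0
  have hp2 : p ≠ 2 := by omega
  have hpb' : (p : ℤ) ≤ shift b j 0 := by rw [shift_zero b hj1]; exact hpb
  have hwin' : (shift b j 0 + 2 : ℤ) < (p : ℤ) ^ 2 := by rw [shift_zero b hj1]; exact hwin
  have h2n : padicNorm p (2 : ℚ) = 1 := padicNorm_two hp2
  have hnu : ∀ y, y < p → classPoleCount b p y = 1 → -(M : ℤ) + 3 ≤ classNu b p y :=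
    fun y hy h1 => by have := (hsing y hy h1).trans (CellA.classExp_le_classNu b p y); omega
  have hnu' : ∀ y, y < p → classPoleCount (shift b j) p y = 1 → -(M : ℤ) + 3 ≤ classNu (shift b j) p y :=
    fun y hy h1 => by have := (hsing' y hy h1).trans (CellA.classExp_le_classNu (shift b j) p y); omega
  obtain ⟨hWb, hVb⟩ := coeff_norm_of_layer b hb hp5 hwin (k := 2) (by omega) hE2 hN2
  obtain ⟨hWb', hVb'⟩ := coeff_norm_of_layer (shift b j) hb' hp5 hwin' (k := 2) (by omega) hE2' hN2'
  have hw2 : padicNorm p (coeffW b / (-(p : ℚ)) ^ (-(M : ℤ) + 3)) ≤ (p : ℚ) ^ (-(2 : ℤ)) :=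
    norm_div_neg_p_zpow (by rw [show -(-(M : ℤ) + 3 + 2) = -((-(M : ℤ) + 2) + 3) by ring]; exact hWb)
  have hv2 : padicNorm p (coeffV b / (-(p : ℚ)) ^ (-(M : ℤ))) ≤ (p : ℚ) ^ (-(2 : ℤ)) :=
    norm_div_neg_p_zpow (by rw [show -(-(M : ℤ) + 2) = -(-(M : ℤ) + 2) by ring]; exact hVb)
  have hw2' : padicNorm p (coeffW (shift b j) / (-(p : ℚ)) ^ (-(M : ℤ) + 3)) ≤ (p : ℚ) ^ (-(2 : ℤ)) :=
    norm_div_neg_p_zpow (by rw [show -(-(M : ℤ) + 3 + 2) = -((-(M : ℤ) + 2) + 3) by ring]; exact hWb')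
  have hv2' : padicNorm p (coeffV (shift b j) / (-(p : ℚ)) ^ (-(M : ℤ))) ≤ (p : ℚ) ^ (-(2 : ℤ)) :=
    norm_div_neg_p_zpow (by rw [show -(-(M : ℤ) + 2) = -(-(M : ℤ) + 2) by ring]; exact hVb')
  have hdet : padicNorm p (coeffW (shift b j) / (-(p : ℚ)) ^ (-(M : ℤ) + 3) * (coeffV b / (-(p : ℚ)) ^ (-(M : ℤ)))
      - coeffW b / (-(p : ℚ)) ^ (-(M : ℤ) + 3) * (coeffV (shift b j) / (-(p : ℚ)) ^ (-(M : ℤ)))) ≤ (p : ℚ) ^ (-(6 : ℤ)) := by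
    by_cases hA : ∃ x < p, (2 ≤ classPoleCount b p x ∧ classExp b p x ≤ -(M : ℤ) + 2) ∨
        (2 ≤ classPoleCount (shift b j) p x ∧ classExp (shift b j) p x ≤ -(M : ℤ) + 2)
    · obtain ⟨x, hx, hx'⟩ := hA
      have hTL : typeExp (tTop T) (tList T) = -(M : ℤ) ∧ tTop T < p := by
        rcases hx' with ⟨h2, hE⟩ | ⟨h2, hE⟩
        · refine ⟨(typeExp_frame_or_top b hb hp5 hpb hMe hT hC hx h2 (by omega)).resolve_right (by omega), ?_⟩
          obtain ⟨a, hdom⟩ := live_dominates b hpb hC hS hx h2 (by omega)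
          have := hdom.le; have := topLevel_lt b hb hwin x; omega
        · refine ⟨(typeExp_frame_or_top (shift b j) hb' hp5 hpb' hMe hT hC' hx h2 (by omega)).resolve_right (by omega), ?_⟩
          obtain ⟨a, hdom⟩ := live_dominates (shift b j) hpb' hC' hS' hx h2 (by omega)
          have := hdom.le; have := topLevel_lt (shift b j) hb' hwin' x; omega
      obtain ⟨hTM, hLp⟩ := hTL
      have hres := liveKappaSum_small_d8 b hb hp5 hpb hwin hM hMe hC.1 hsing (by omega)
      have hres' := liveKappaSum_small_d8 (shift b j) hb' hp5 hpb' hwin' hM hMe hC'.1 hsing' (by rw [dOf_shift b hj1 hj7]; omega)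
      obtain ⟨A, -, hW, hV⟩ :=
        aggregate₅_d8 b hb hp5 hpb hwin hM hMe hT hC hS fourthDigitW_holds fourthDigitV_holds hsing hTM hres
      obtain ⟨A', -, hW', hV'⟩ :=
        aggregate₅_d8 (shift b j) hb' hp5 hpb' hwin' hM hMe hT hC' hS' fourthDigitW_holds fourthDigitV_holds hsing' hTM hres'
      have hAt : ∀ {c At : ℚ}, padicNorm p c ≤ (p : ℚ) ^ (-(2 : ℤ)) → padicNorm p (2 * c - At) ≤ (p : ℚ) ^ (-(4 : ℤ)) →
          padicNorm p At ≤ (p : ℚ) ^ (-(2 : ℤ)) := by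
        intro c At hc hr
        have e : At = 2 * c - (2 * c - At) := by ring
        rw [e]
        refine fo_sub ?_ (fo_weak hr (by norm_num))
        rw [padicNorm.mul, h2n, one_mul]; exact hc
      exact det₆ hp2 hW hV hW' hV' (hAt hw2 hW) (hAt hv2 hV) (hAt hw2' hW') (hAt hv2' hV')
    · have hall : ∀ x < p, 2 ≤ classPoleCount b p x → -(M : ℤ) + 3 ≤ classExp b p x := fun x hx h2 => by
        by_contra h; exact hA ⟨x, hx, Or.inl ⟨h2, by omega⟩⟩
      have hall' : ∀ x < p, 2 ≤ classPoleCount (shift b j) p x → -(M : ℤ) + 3 ≤ classExp (shift b j) p x :=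
        fun x hx h2 => by
          by_contra h; exact hA ⟨x, hx, Or.inr ⟨h2, by omega⟩⟩
      obtain ⟨hWt, hVt⟩ := coeff_norm_of_layer b hb hp5 hwin (k := 3) (by omega) hall hnu
      obtain ⟨hWt', hVt'⟩ := coeff_norm_of_layer (shift b j) hb' hp5 hwin' (k := 3) (by omega) hall' hnu'
      have hw := norm_div_neg_p_zpow hWt
      have hv := norm_div_neg_p_zpow hVt
      have hw' := norm_div_neg_p_zpow hWt'
      have hv' := norm_div_neg_p_zpow hVt'
      exact fo_sub (fo_weak (fo_mul hw' hv) (by norm_num)) (fo_weak (fo_mul hw hv') (by norm_num))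
  set w := coeffW b / (-(p : ℚ)) ^ (-(M : ℤ) + 3)
  set v := coeffV b / (-(p : ℚ)) ^ (-(M : ℤ))
  set w' := coeffW (shift b j) / (-(p : ℚ)) ^ (-(M : ℤ) + 3)
  set v' := coeffV (shift b j) / (-(p : ℚ)) ^ (-(M : ℤ))
  have hcasE : casoratian b j = (-(p : ℚ)) ^ (-(M : ℤ) + 3) * (-(p : ℚ)) ^ (-(M : ℤ)) * (w' * v - w * v') := by
    have e1 : coeffW b = w * (-(p : ℚ)) ^ (-(M : ℤ) + 3) := by
      simp only [w]; rw [div_mul_cancel₀ _ (zpow_ne_zero _ hpneg)]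
    have e2 : coeffV b = v * (-(p : ℚ)) ^ (-(M : ℤ)) := by
      simp only [v]; rw [div_mul_cancel₀ _ (zpow_ne_zero _ hpneg)]
    have e3 : coeffW (shift b j) = w' * (-(p : ℚ)) ^ (-(M : ℤ) + 3) := by
      simp only [w']; rw [div_mul_cancel₀ _ (zpow_ne_zero _ hpneg)]
    have e4 : coeffV (shift b j) = v' * (-(p : ℚ)) ^ (-(M : ℤ)) := by
      simp only [v']; rw [div_mul_cancel₀ _ (zpow_ne_zero _ hpneg)]
    unfold casoratian
    rw [e1, e2, e3, e4]; ring
  apply val_ge_of_padicNorm_le hcas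
  rw [hcasE, padicNorm.mul, padicNorm.mul, LevelClass.padicNorm_neg_p_zpow, LevelClass.padicNorm_neg_p_zpow]
  calc (p : ℚ) ^ (-(-(M : ℤ) + 3)) * (p : ℚ) ^ (-(-(M : ℤ))) * padicNorm p (w' * v - w * v')
      ≤ (p : ℚ) ^ (-(-(M : ℤ) + 3)) * (p : ℚ) ^ (-(-(M : ℤ))) * (p : ℚ) ^ (-(6 : ℤ)) :=
        mul_le_mul_of_nonneg_left hdet (mul_nonneg (zpow_p_nonneg _) (zpow_p_nonneg _))
    _ = (p : ℚ) ^ (-((9 : ℤ) - 2 * M)) := by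
        rw [← zpow_add₀ hp0, ← zpow_add₀ hp0]; congr 1; ring

end Summit.KontsevichZagierPeriods.Zeta5Search.SecondOrder

end
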